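import Mathlib

/-!
# Advice entropy bound for the advice–tie-break canonisation scheme (`NoHiddenOrder`, stmt-PneNP-14781)

Route `PneNP/SymmetryBudget`, dichotomy `NoHiddenOrder` (stmt-PneNP-14781) / `WindowBarrier`
(stmt-PneNP-2145).  In the advice–tie-break scheme (memo ANALYSIS-3.md, evidence on both items, Theorem A) the
flat symmetric window canoniser is indexed by ADVICE labellings `μ : W → ℕ` of the `g` window vertices whose
ENTROPY `log₂ (g! / ∏_j |μ⁻¹(j)|!)` is at most `K·g`; the advice that makes the Corneil–Goldberg run succeed is
`μ(x) = ℓ(x)` (the pass-over chain length, a positive integer) on the `t` individualised vertices and `0`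
elsewhere.  This file proves the purely arithmetic inequality that converts a bound on `Σ_x log₂ ℓ(x)` into the
required entropy bound:

* code length `2·⌊log₂ j⌋ + 1` (Elias-γ, written inline); `AdviceEntropy.kraft_codeLen`: its Kraft
  sum over any finite set of positive integers is `≤ 1` (dyadic blocks contribute `2^{-(k+1)}` each);
* `AdviceEntropy.factorial_le_prod_factorial_mul_two_pow` — for `f : Fin t → ℕ` with positive values,
  `t! ≤ (∏_{j ∈ im f} |f⁻¹(j)|!) · 2^{Σ_i (2 * Nat.log 2 (f i) + 1)}`, i.e. `log₂ multinomial ≤ total code length`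
  (one term of the multinomial expansion of `(Σ_j 2^{-codeLen j})^t ≤ 1` — Gibbs/Kraft in finite form);
* `AdviceEntropy.factorial_le_advice_bound` — with the unlabelled class of size `g − t` added:
  `g! ≤ (g−t)! · (∏_j |f⁻¹(j)|!) · 2^{g + Σ_i (2 * Nat.log 2 (f i) + 1)}`, the form `H(μ_Σ) ≤ g + t + 2 Σ_x ⌊log₂ ℓ(x)⌋` used
  in ANALYSIS-3 §2.

Elementary; Mathlib only; supports stmt-PneNP-14781 (does not close it).
-/

-- `Summit.PneNP.PneNP.…` duplicates `PneNP` BY DESIGN (single-problem summit, D-0017 layout).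
set_option linter.dupNamespace false

namespace Summit.PneNP.PneNP.Theorems

namespace AdviceEntropy

open Finset

/-- On the dyadic block `[2^k, 2^{k+1})` the code length is the constant `2k+1`. -/
theorem codeLen_eq_of_mem_Ico {k j : ℕ} (hj : j ∈ Ico (2 ^ k) (2 ^ (k + 1))) :
    2 * Nat.log 2 j + 1 = 2 * k + 1 := by
  rw [mem_Ico] at hj
  rw [Nat.log_eq_of_pow_le_of_lt_pow hj.1 hj.2]

/-- Kraft sum of one dyadic block: `Σ_{j ∈ [2^k,2^{k+1})} 2^{-codeLen j} = 2^{-(k+1)}`. -/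
theorem sum_Ico_pow_codeLen (k : ℕ) :
    ∑ j ∈ Ico (2 ^ k) (2 ^ (k + 1)), ((1 : ℝ) / 2) ^ (2 * Nat.log 2 j + 1) = ((1 : ℝ) / 2) ^ (k + 1) := by
  rw [sum_congr rfl fun j hj => by rw [codeLen_eq_of_mem_Ico hj], sum_const, Nat.card_Ico, nsmul_eq_mul]
  have h2 : (2 : ℕ) ^ (k + 1) - 2 ^ k = 2 ^ k := by rw [pow_succ]; omega
  rw [h2, Nat.cast_pow, Nat.cast_two]
  rw [show 2 * k + 1 = k + (k + 1) by ring, pow_add, ← mul_assoc, ← mul_pow]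
  norm_num

/-- Kraft sum over `[1, 2^K)`: `Σ 2^{-codeLen j} = 1 − 2^{-K} `. -/
theorem sum_Ico_one_pow_codeLen (K : ℕ) :
    ∑ j ∈ Ico 1 (2 ^ K), ((1 : ℝ) / 2) ^ (2 * Nat.log 2 j + 1) = 1 - ((1 : ℝ) / 2) ^ K := by
  induction K with
  | zero => simp
  | succ K ih =>
    rw [← Finset.Ico_union_Ico_eq_Ico (Nat.one_le_two_pow) (Nat.pow_le_pow_right (by norm_num) K.le_succ),
      sum_union (Ico_disjoint_Ico_consecutive _ _ _), ih, sum_Ico_pow_codeLen, pow_succ]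
    ring

/-- **Kraft inequality for the Elias-γ lengths**: over any finite set of positive integers,
`Σ_j 2^{-codeLen j} ≤ 1`. -/
theorem kraft_codeLen (J : Finset ℕ) (hJ : ∀ j ∈ J, 1 ≤ j) :
    ∑ j ∈ J, ((1 : ℝ) / 2) ^ (2 * Nat.log 2 j + 1) ≤ 1 := by
  -- `J ⊆ [1, 2^K)` for `K` large
  obtain ⟨K, hK⟩ : ∃ K, ∀ j ∈ J, j < 2 ^ K :=
    ⟨J.sup id, fun j hj => lt_of_le_of_lt (le_sup (f := id) hj) Nat.lt_two_pow_self⟩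
  have hsub : J ⊆ Ico 1 (2 ^ K) := fun j hj => mem_Ico.2 ⟨hJ j hj, hK j hj⟩
  calc ∑ j ∈ J, ((1 : ℝ) / 2) ^ (2 * Nat.log 2 j + 1) ≤ ∑ j ∈ Ico 1 (2 ^ K), ((1 : ℝ) / 2) ^ (2 * Nat.log 2 j + 1) :=
        sum_le_sum_of_subset_of_nonneg hsub fun _ _ _ => by positivity
    _ = 1 - ((1 : ℝ) / 2) ^ K := sum_Ico_one_pow_codeLen K
    _ ≤ 1 := by
        have : (0 : ℝ) ≤ ((1 : ℝ) / 2) ^ K := by positivity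
        linarith

/-- The class sizes of `f` sum to `t`. -/
theorem sum_card_fiber {t : ℕ} (f : Fin t → ℕ) :
    ∑ j ∈ univ.image f, (univ.filter fun i => f i = j).card = t := by
  rw [← card_eq_sum_card_image f univ, card_univ, Fintype.card_fin]

/-- **`log₂ multinomial ≤ total code length`** (finite Gibbs/Kraft): for `f : Fin t → ℕ` with positive values and
class sizes `n_j = |f⁻¹(j)|`, `t! ≤ (∏_j n_j!) · 2^{Σ_i (2 * Nat.log 2 (f i) + 1)}`.  Proof: the term `k = n` of the
multinomial expansion of `(Σ_j q_j)^t`, `q_j = 2^{-codeLen j}`, is at most the whole sum, which is `≤ 1` by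
`kraft_codeLen`. -/
theorem factorial_le_prod_factorial_mul_two_pow {t : ℕ} (f : Fin t → ℕ) (hf : ∀ i, 1 ≤ f i) :
    t.factorial ≤ (∏ j ∈ univ.image f, (univ.filter fun i => f i = j).card.factorial) *
      2 ^ (∑ i, (2 * Nat.log 2 (f i) + 1)) := by
  classical
  set J : Finset ℕ := univ.image f with hJ
  set n : ℕ → ℕ := fun j => (univ.filter fun i => f i = j).card with hn
  set q : ℕ → ℝ := fun j => ((1 : ℝ) / 2) ^ (2 * Nat.log 2 j + 1) with hq
  have hJpos : ∀ j ∈ J, 1 ≤ j := by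
    intro j hj
    obtain ⟨i, -, rfl⟩ := mem_image.1 hj
    exact hf i
  have hsum : ∑ j ∈ J, n j = t := sum_card_fiber f
  -- the multinomial expansion, one term
  have hexp := Finset.sum_pow_eq_sum_piAntidiag J q t
  have hnmem : n ∈ J.piAntidiag t := by
    rw [mem_piAntidiag]
    refine ⟨hsum, fun j hj => ?_⟩
    -- `n j ≠ 0 → j ∈ J`
    by_contra hjJ
    apply hj
    rw [hn]
    simp only [card_eq_zero, filter_eq_empty_iff, mem_univ, true_implies]
    intro i hi
    exact hjJ (mem_image.2 ⟨i, mem_univ _, hi⟩)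
  have hterm : (Nat.multinomial J n : ℝ) * ∏ j ∈ J, q j ^ n j ≤ (∑ j ∈ J, q j) ^ t := by
    rw [hexp]
    refine single_le_sum (f := fun k => (Nat.multinomial J k : ℝ) * ∏ j ∈ J, q j ^ k j) ?_ hnmem
    intro k _
    exact mul_nonneg (Nat.cast_nonneg _) (prod_nonneg fun j _ => by positivity)
  have hle1 : (∑ j ∈ J, q j) ^ t ≤ 1 := pow_le_one₀ (sum_nonneg fun _ _ => by positivity) (kraft_codeLen J hJpos)
  -- the product of the `q_j ^ n_j` is `2^{-Σ_i (2 * Nat.log 2 (f i) + 1)}`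
  have hprod : ∏ j ∈ J, q j ^ n j = ((1 : ℝ) / 2) ^ (∑ i, (2 * Nat.log 2 (f i) + 1)) := by
    simp only [hq, ← pow_mul]
    rw [prod_pow_eq_pow_sum]
    congr 1
    -- `Σ_j codeLen j * n j = Σ_i (2 * Nat.log 2 (f i) + 1)`
    rw [hJ]
    rw [← sum_fiberwise_of_maps_to (s := univ) (t := univ.image f) (g := f) (fun i hi => mem_image_of_mem f hi)
      (fun i => (2 * Nat.log 2 (f i) + 1))]
    refine sum_congr rfl fun j _ => ?_
    rw [sum_congr rfl fun i hi => by rw [(mem_filter.1 hi).2], sum_const, smul_eq_mul, mul_comm]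
  -- assemble: multinomial * 2^{-L} ≤ 1, multinomial * ∏ n_j! = t!
  have hspec := Nat.multinomial_spec J n
  rw [hsum] at hspec
  have hmul : (Nat.multinomial J n : ℝ) ≤ 2 ^ (∑ i, (2 * Nat.log 2 (f i) + 1)) := by
    have h := (hterm.trans hle1)
    rw [hprod] at h
    have hpow : (0 : ℝ) < ((1 : ℝ) / 2) ^ (∑ i, (2 * Nat.log 2 (f i) + 1)) := by positivity
    have : (Nat.multinomial J n : ℝ) ≤ 1 / ((1 : ℝ) / 2) ^ (∑ i, (2 * Nat.log 2 (f i) + 1)) := by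
      rw [le_div_iff₀ hpow]; exact h
    simpa [one_div, inv_pow, inv_inv] using this
  have hmulN : Nat.multinomial J n ≤ 2 ^ (∑ i, (2 * Nat.log 2 (f i) + 1)) := by exact_mod_cast hmul
  calc t.factorial = (∏ j ∈ J, (n j).factorial) * Nat.multinomial J n := hspec.symm
    _ ≤ (∏ j ∈ J, (n j).factorial) * 2 ^ (∑ i, (2 * Nat.log 2 (f i) + 1)) := Nat.mul_le_mul_left _ hmulN

/-- **Advice entropy bound** (the form used in ANALYSIS-3 §2): adding an unlabelled class of size `g − t`,
`g! ≤ (g−t)! · (∏_j n_j!) · 2^{g + Σ_i (2 * Nat.log 2 (f i) + 1)}`; in words, the entropy of a labelling of `g` points that is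
`0` on `g − t` of them and a positive integer `f i` on the others is at most `g + t + 2·Σ_i ⌊log₂ (f i)⌋`. -/
theorem factorial_le_advice_bound {g t : ℕ} (ht : t ≤ g) (f : Fin t → ℕ) (hf : ∀ i, 1 ≤ f i) :
    g.factorial ≤ (g - t).factorial * (∏ j ∈ univ.image f, (univ.filter fun i => f i = j).card.factorial) *
      2 ^ (g + ∑ i, (2 * Nat.log 2 (f i) + 1)) := by
  have h1 : g.factorial = g.choose t * (t.factorial * (g - t).factorial) := by
    rw [← mul_assoc, Nat.choose_mul_factorial_mul_factorial ht]
  have h2 := factorial_le_prod_factorial_mul_two_pow f hf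
  have h3 : g.choose t ≤ 2 ^ g := Nat.choose_le_two_pow g t
  rw [h1, pow_add]
  calc g.choose t * (t.factorial * (g - t).factorial)
      ≤ 2 ^ g * ((∏ j ∈ univ.image f, (univ.filter fun i => f i = j).card.factorial) *
          2 ^ (∑ i, (2 * Nat.log 2 (f i) + 1)) * (g - t).factorial) := by gcongr
    _ = (g - t).factorial * (∏ j ∈ univ.image f, (univ.filter fun i => f i = j).card.factorial) *
          (2 ^ g * 2 ^ (∑ i, (2 * Nat.log 2 (f i) + 1))) := by ring

/-- The total code length is `t + 2·Σ_i ⌊log₂ (f i)⌋`. -/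
theorem sum_codeLen_eq {t : ℕ} (f : Fin t → ℕ) :
    ∑ i, (2 * Nat.log 2 (f i) + 1) = t + 2 * ∑ i, Nat.log 2 (f i) := by
  simp only [sum_add_distrib, sum_const, card_univ, Fintype.card_fin, smul_eq_mul, mul_one, mul_sum]
  ring

end AdviceEntropy

end Summit.PneNP.PneNP.Theorems
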